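import Literature.NumberTheory.Automorphic.Liu2021.Def411WeilCarriersDoubling
import Literature.NumberTheory.Automorphic.Liu2021.Def411WeilCarriers
import Literature.RepresentationTheory.Liu2021.OscillatorConventions
import Summits.HodgeConjecture.CorCM.B01.Transposition.Item6MuOfInverseType
import Summits.HodgeConjecture.CorCM.B01.Transposition.HComp.HermSpaceDiagonalFrame
import HarnessLib

/-!
# The ω-part's splitting binders `s / hs / hsc` at the splitting ATTACHED TO `μ(Φ, ι₁)` (staged plug; pin-3's hand)

By-import form of the junction `JunctionStage1.lean` (400651759a89, rc 0): the three displayed splitting binders of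
`Model.faceSupply_of_thm418AsPrinted_along_conj_holds_restOne_omega` (pin-3 ω-part v3 95beaa4e2094 :96–:103) as
TERMS `sMu / hsMu / hscMu`, from `Def411WeilCarriersDoubling.chiSplittingLine` at the Hecke character
`chiMu F ι₁ Φ := toHeckeCharacter F (muAny F ι₁ Φ)` — Liu's `μ(Φ, ι₁)` (`muOfInvType`) on the Galois branch
(`chiMu_eq`), an inert conjugate-symplectic character of CM type `Φ` elsewhere (never read: every consumer hypothesis
is guarded by `IsGalois ℚ F`, the first re-cut's device fe3de873e6c6 :39–:40).  HC_CM is NOT proved here; nothing in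
this file inhabits `hLiu / hObj / hirr / hM`.
-/

set_option autoImplicit false

noncomputable section


open scoped Classical
open scoped Matrix Kronecker TensorProduct
open NumberField IsDedekindDomain
open Literature.RepresentationTheory.HeisenbergGroup
open Literature.NumberTheory.Weil1964

namespace Summit.HodgeConjecture.CorCM.Transposition.OmegaMuSplitting

open Literature.AlgebraicGeometry.Motives (CMType)
open Literature.NumberTheory.Automorphic
open Literature.NumberTheory.Automorphic.IdeleClassGroup
open Literature.NumberTheory.GaloisRepresentations
open Literature.RepresentationTheory.HarrisKudlaSweet1996
open Literature.RepresentationTheory.Liu2021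
open Literature.NumberTheory.GelbartRogawski1991
open Literature.NumberTheory.GelbartRogawski1991.UnitaryDualPair
open Literature.NumberTheory.GelbartRogawski1991.GRConstruction
open Literature.NumberTheory.Automorphic.Liu2021.Def411WeilCarriersDoubling
open Literature.NumberTheory.Automorphic.Liu2021.Def411WeilCarriers (TW JW JW_eq isSymm_TW isUnit_det_TW)

/-- Liu's `μ(Φ, ι₁)` where it exists (`F/ℚ` Galois), an inert conjugate-symplectic weight-one character of CM type `Φ`
elsewhere (never read: every consumer hypothesis is guarded by `IsGalois ℚ F`, as in pin-3's first re-cut). -/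
def muAny (F : CMField) (ι₁ : F →+* ℂ) (Φ : CMType F) : IdeleClassGroup F →ₜ* Circle :=
  if h : IsGalois ℚ F then @muOfInvType F h ι₁ Φ
  else (IdeleClassGroup.exists_isConjugateSymplectic_hasCMType (L := F) Φ).choose

/-- On the Galois branch `muAny` IS Liu's chosen character `μ(Φ, ι₁) = muOfInvType ι₁ Φ` (`dif_pos`). [folklore] -/
theorem muAny_eq (F : CMField) [h : IsGalois ℚ F] (ι₁ : F →+* ℂ) (Φ : CMType F) :
    muAny F ι₁ Φ = muOfInvType ι₁ Φ :=
  dif_pos h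

/-- `muAny` is conjugate symplectic ([Liu2021] Def. 4.1), on both branches. [cite: Liu2021, Def. 4.1] -/
theorem isConjugateSymplectic_muAny (F : CMField) (ι₁ : F →+* ℂ) (Φ : CMType F) :
    IdeleClassGroup.IsConjugateSymplectic F (muAny F ι₁ Φ) := by
  unfold muAny
  split_ifs with h
  · exact @isConjugateSymplectic_muOfInvType F h ι₁ Φ
  · exact (IdeleClassGroup.exists_isConjugateSymplectic_hasCMType (L := F) Φ).choose_spec.1

/-- `χ_μ := μ` as a Hecke character. -/
def chiMu (F : CMField) (ι₁ : F →+* ℂ) (Φ : CMType F) : HeckeCharacter F :=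
  toHeckeCharacter F (muAny F ι₁ Φ)

/-- `χ_μ` is a unitary Hecke character (`isUnitary_toHeckeCharacter`). [folklore] -/
theorem chiMu_isUnitary (F : CMField) (ι₁ : F →+* ℂ) (Φ : CMType F) : (chiMu F ι₁ Φ).IsUnitary :=
  isUnitary_toHeckeCharacter F (muAny F ι₁ Φ)

/-- `χ_μ` is a splitting character for `U(1)` (`IsSplittingChar F 1`): a conjugate-symplectic character is an oscillator
character (`isOscillatorChar_toHeckeCharacter_iff`), [GR91] §3.1. [cite: GelbartRogawski1991, §3.1] -/
theorem chiMu_isSplittingChar (F : CMField) (ι₁ : F →+* ℂ) (Φ : CMType F) : IsSplittingChar F 1 (chiMu F ι₁ Φ) :=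
  (isOscillatorChar_toHeckeCharacter_iff (muAny F ι₁ Φ)).mpr (isConjugateSymplectic_muAny F ι₁ Φ)

set_option maxHeartbeats 4000000 in
/-- pin-3 ω-part v2 binder `s` (:96–:98), VERBATIM type, as a term. -/
def sMu : ∀ (F : CMField) (ι₁ : F →+* ℂ) (V : HermSpace3 F ι₁) (_ : CMType F) (a : (↥(maximalRealSubfield F))ˣ),
      UnitaryGroup.adelicPair ↥(maximalRealSubfield F) F (IsCMField.complexConj F) 3 1 (Matrix.diagonal V.diagEntries)
          (JW ↥(maximalRealSubfield F) F a) →*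
        adelicMpCont ↥(maximalRealSubfield F) (Fin (3 * 1))
          (adelicGram ↥(maximalRealSubfield F) finProdFinEquiv
            (realDiagonal F V.diagEntries V.complexConj_diagEntries) (TW ↥(maximalRealSubfield F) a)) :=
  fun F ι₁ V Φ a =>
    chiSplittingLine F finProdFinEquiv V.diagEntries V.complexConj_diagEntries V.diagEntries_ne_zero (chiMu F ι₁ Φ)
      (chiMu_isUnitary F ι₁ Φ) (chiMu_isSplittingChar F ι₁ Φ) (TW ↥(maximalRealSubfield F) a)
      (isUnit_det_TW ↥(maximalRealSubfield F) a) (JW ↥(maximalRealSubfield F) F a) (JW_eq ↥(maximalRealSubfield F) F a)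

set_option maxHeartbeats 4000000 in
/-- pin-3 ω-part v2 binder `hs` (:99–:100), VERBATIM type, as a theorem. -/
theorem hsMu : ∀ (F : CMField) (ι₁ : F →+* ℂ) (V : HermSpace3 F ι₁) (Φ : CMType F) (a : (↥(maximalRealSubfield F))ˣ),
    (splittingDatum ↥(maximalRealSubfield F) F (IsCMField.complexConj F) 3 1 finProdFinEquiv
        (Matrix.diagonal V.diagEntries) (JW ↥(maximalRealSubfield F) F a) (complexConj_imagUnit F) (imagUnit_ne_zero F)
        (imagUnit_mul_self F) (realDiagonal_isSymm F V.diagEntries V.complexConj_diagEntries)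
        (isSymm_TW ↥(maximalRealSubfield F) a)
        (isUnit_det_realDiagonal F V.diagEntries V.complexConj_diagEntries V.diagEntries_ne_zero)
        (isUnit_det_TW ↥(maximalRealSubfield F) a)
        (realDiagonal_map F V.diagEntries V.complexConj_diagEntries).symm (JW_eq ↥(maximalRealSubfield F) F a)).IsCompatible
      (sMu F ι₁ V Φ a) :=
  fun F ι₁ V Φ a =>
    isCompatible_chiSplittingLine F finProdFinEquiv V.diagEntries V.complexConj_diagEntries V.diagEntries_ne_zero
      (chiMu F ι₁ Φ) (chiMu_isUnitary F ι₁ Φ) (chiMu_isSplittingChar F ι₁ Φ) (TW ↥(maximalRealSubfield F) a)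
      (isSymm_TW ↥(maximalRealSubfield F) a) (isUnit_det_TW ↥(maximalRealSubfield F) a) (JW ↥(maximalRealSubfield F) F a)
      (JW_eq ↥(maximalRealSubfield F) F a)

set_option maxHeartbeats 4000000 in
/-- pin-3 ω-part v2 binder `hsc` (:101–:103), VERBATIM type, as a theorem. -/
theorem hscMu : ∀ (F : CMField) (ι₁ : F →+* ℂ) (V : HermSpace3 F ι₁) (Φ : CMType F) (a : (↥(maximalRealSubfield F))ˣ),
    Continuous (pairSplitting ↥(maximalRealSubfield F) F (IsCMField.complexConj F) 3 1 finProdFinEquiv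
      (Matrix.diagonal V.diagEntries) (JW ↥(maximalRealSubfield F) F a) (sMu F ι₁ V Φ a)) :=
  fun F ι₁ V Φ a =>
    continuous_pairSplitting_chiSplittingLine F finProdFinEquiv V.diagEntries V.complexConj_diagEntries
      V.diagEntries_ne_zero (chiMu F ι₁ Φ) (chiMu_isUnitary F ι₁ Φ) (chiMu_isSplittingChar F ι₁ Φ)
      (TW ↥(maximalRealSubfield F) a) (isUnit_det_TW ↥(maximalRealSubfield F) a) (JW ↥(maximalRealSubfield F) F a)
      (JW_eq ↥(maximalRealSubfield F) F a)

/-- on the Galois branch the character IS Liu's `μ(Φ, ι₁)` (the attachment the GUARD asks for). -/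
theorem chiMu_eq (F : CMField) [IsGalois ℚ F] (ι₁ : F →+* ℂ) (Φ : CMType F) :
    chiMu F ι₁ Φ = toHeckeCharacter F (muOfInvType ι₁ Φ) := by
  rw [chiMu, muAny_eq]

end Summit.HodgeConjecture.CorCM.Transposition.OmegaMuSplitting

end
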